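import Summits.ABC.IUTFork.Cor312NotLicencePrVolSharpRealises
import Literature.IUT.LogVolume.TensorPacketContentBounds
import HarnessLib

/-!
# [IUTchIII] Cor. 3.12, Step (xi-f) `Licence` at the print-normalised assembled real setting with SHARP pilot
# regions — an EXPLICIT large-order threshold in the printed constants `d`, `a`, `b` of [IUTchIV] Prop. 1.2

PROOF-ONLY record file (D-0012; no definitions, no `Prop` facts) of the abc-iut cell (WAVE-5 discharge seat
abc-iut-w5-d107, gen 6; constant-tuple companion of the C-R12 (b) / (E3) case-A results of abc-iut-C-cert-2 (p433664),
abc-iut-w4-d026 (p432372/p432773) and this seat (p433872/p435430/p436396)). TAKES NO SIDE on [IUTchIII] Cor. 3.12.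

The parent files refute Step (xi-f)'s `Licence` at abc-iut-c312-7's `Real.settingPrVolSharp … tq t …` for every datum
whose `q`-idele is small at one place `x₀ | p` against a threshold `C` (resp. `ε`) that was only shown to EXIST. THIS
FILE makes the threshold EXPLICIT, by NAME from campaign-S's kernel proof of [IUTchIV] Prop. 1.2 (ii)
(`iota_smul_normalizedPacket_subset_zpow_smul_logPacket` = «`ι_i(g)·(R_I)^∼ ⊆ p^{⌊λ−d_I−a_I⌋}·log_p(R_I^×)`»,
`ppow_smul_logPacket_subset` = «`p^n·log_p(R_I^×) ⊆ p^n·(⊗h_i)·(R_I)^∼`, `‖h_i‖ = p^{b_i}`», abc-iut-S6 `prop12ii_holds`):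

* §1 `norm_dEquiv_le_of_mem_zpow_smul_logPacket` — every field-factor coordinate of an element of `p^n·log_p(R_I^×)`
  has norm `≤ p^{−n}·p^{b_I}` ([IUTchIV] Prop. 1.2 (i), last inclusion of the chain on p. 11);
* §2 **`not_licence_settingPrVolSharp_of_explicit`**: for nonzero Θ-ideles and a place `x₀ | p`, label `j = i+1`, with
  `K := F_{x₀}`, `e = e(K/ℚ_p)`, `d = d_K` (`differentOrd`), `a = a_K` (`logRadiusA p e`), `b = b_K` (`logRadiusB p e`):
  `p^{(j+1)(d+a+b)+1} · ‖t_{Θ,j,x₀}‖ < ‖t_{q,x₀}‖ ⟹ ¬ Thm311ToCor312.Licence (settingPrVolSharp … tq t …)` — the parent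
  criterion `not_licence_settingPrVolSharp_of_latticeBound` at the CONSTANT tuple `(x₀,…,x₀)` with the capsule-symmetric
  scalar function `v⃗ ↦ p^{⌊min_a λ(v⃗_a) − d_{I_{v⃗}} − a_{I_{v⃗}}⌋}·(2p)^{j+1}` (`‖t_{Θ,j,v}‖ = p^{−λ(v)}`) and radii
  `ψ_{v⃗}(p^{N(v⃗)}·⊗h)`;
* §3 **`not_licence_settingPrVolSharp_of_realises_explicit`**: for ideles REALISING `P_Θ = j²·P_q`
  (`‖t_{Θ,j,v}‖ = ‖t_{q,v}‖^{j²}`): `p^{(j+1)(d+a+b)+1} · ‖t_{q,x₀}‖^{j²−1} < 1 ⟹ ¬ Licence`, i.e. in orders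
  «`(j²−1)·ord_p(t_{q,x₀}) > (j+1)·(d+a+b) + 1`»; and the S_H form `…_not_pilotKummerCompatHull_…` under the q-pin.

READING (neutral, numbers not adjectives). With `ord_p(t_{q,v}) = P_q(v)·[F_v:ℚ_p]⁻¹·ord-normalisation = ord_v(q_v)/(2l·e_v)`
this is an EFFECTIVE case-A region: e.g. at an absolutely unramified bad place of odd residue characteristic
(`e = 1`, `d = 0`) and label `j = ℓ⋇` it reads `(ℓ⋇−1)·ord_p(t_q) > a + b + 1/(ℓ⋇+1)`. Below the threshold NOTHING is
claimed (case B: the (Ind2) log-shell inflation — ALL `j+1` slots contribute — may cover the q-box; abc-iut-w4-d094's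
«LICENCE-CASE-B-REACH»). Statements about OUR typed objects in the SHARP reading; nothing about the NUMBER-level
Corollary (`Cor22.Cor312AtDatum`) or any author's intended reading. [claim: Mochizuki2012, status: disputed] for
[IUTchIII] Cor. 3.12 Step (xi-f); [cite: Mochizuki2012, IUTchIV Prop. 1.2 (i)(ii) p. 10–11]; [cite: DupuyHilado2025,
§3.9, §4.9, §4.10]; [cite: ScholzeStix2018, §2.2 pp. 9–10]. HONEST FRAMING: nothing here asserts that abc or [IUTchIII]
Cor. 3.12 is proved or refuted; typed ≠ proved; instantiated ≠ endorsed.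
-/

noncomputable section

open Set Function NumberField IsDedekindDomain
open scoped Pointwise

namespace Literature.IUT.LogVolume

/-! ## §1. Field-factor coordinates on `p^n·log_p(R_I^×)` -/

variable (p : ℕ) [Fact p.Prime] {I : Type} [Fintype I] [DecidableEq I] [Nonempty I]
  (k : I → Type) [∀ i, NontriviallyNormedField (k i)] [∀ i, NormedAlgebra ℚ_[p] (k i)]
  [∀ i, IsUltrametricDist (k i)] [∀ i, ProperSpace (k i)]

omit [Nonempty I] in
/-- **`ψ_j(p^n·⊗h_i)` has norm `p^{−n}·p^{b_I}`** for a realisation `h` of `p^{−b_I}`. [cite: Mochizuki2012, IUTchIV Prop. 1.2 (i) p. 10] -/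
theorem norm_dEquiv_ppow_mul_purePacket {h : Π i, k i} (hh : RealizesNegB p k h) (n : ℤ) (J : DIdx p k) :
    ‖dEquiv p k (ppow p k n * purePacket p k h) J‖ = (p : ℝ) ^ (-n) * (p : ℝ) ^ bSum p k := by
  have hprod : ‖dEquiv p k (purePacket p k h) J‖ = (p : ℝ) ^ bSum p k := by
    rw [psi_purePacket_apply, norm_prod, ← prod_norm_of_realizesNegB p k hh]
    exact Finset.prod_congr rfl fun i _ => norm_factorEmb p k (DFac p k) (dEquiv p k) i J (h i)
  rw [map_mul, Pi.mul_apply, norm_mul, norm_psi_ppow_apply, hprod]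

/-- **Every field-factor coordinate of an element of `p^n·log_p(R_I^×)` has norm `≤ p^{−n}·p^{b_I}`** (the chain
`p^n·log_p(R_I^×) ⊆ p^n·(⊗h_i)·(R_I)^∼`, `ψ((R_I)^∼) = Π 𝒪_{L_j}`). [cite: Mochizuki2012, IUTchIV Prop. 1.2 (i) p. 10–11] -/
theorem norm_dEquiv_le_of_mem_zpow_smul_logPacket {h : Π i, k i} (hh : RealizesNegB p k h) (n : ℤ)
    {y : PacketAlgebra p k} (hy : y ∈ ((p : ℚ_[p]) ^ n) • (logPacket p k : Set (PacketAlgebra p k))) (J : DIdx p k) :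
    ‖dEquiv p k y J‖ ≤ ‖dEquiv p k (ppow p k n * purePacket p k h) J‖ := by
  rw [← ppow_smul_set_eq] at hy
  obtain ⟨w, hw, rfl⟩ := ppow_smul_logPacket_subset p k hh n hy
  have hwJ : ‖dEquiv p k w J‖ ≤ 1 := by
    have hmem : dEquiv p k w ∈ dEquiv p k '' (normalizedPacket p k : Set (PacketAlgebra p k)) := ⟨w, hw, rfl⟩
    rw [image_normalizedPacket_eq_coe, coe_piUnitBallStructure, mem_polydisc] at hmem
    exact hmem J
  show ‖dEquiv p k ((ppow p k n * purePacket p k h) * w) J‖ ≤ _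
  rw [map_mul, Pi.mul_apply, norm_mul]
  exact mul_le_of_le_one_right (norm_nonneg _) hwJ

end Literature.IUT.LogVolume

namespace Summit.ABC

namespace IUTFork

namespace Thm311

namespace Real

open Cor312 Cor312Vol Literature.IUT.LogThetaLattice Literature.IUT.LogVolume

variable {F : Type} [Field F] [NumberField F] (X : PilotData F) {logv : PadicLogs F} (hlog : LogvAnalytic logv)
  (M : Type) [Field M] [NumberField M]
  (archPk : ∀ (j : (thetaIndex X).Label) (vQ : (thetaIndex X).VQ), Set ((logShellsDH X logv).Packet j vQ))
  (archSub : ∀ (j : (thetaIndex X).Label) (v : (thetaIndex X).V),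
    Set ((logShellsDH X logv).Packet j ((thetaIndex X).over v)))
  (Ψ : ℤ → ∀ v : (thetaIndex X).V, v ∈ (thetaIndex X).Vbad → Set ((logShellsDH X logv).StarPacket v))
  (act : ℤ → ∀ v : (thetaIndex X).V, v ∈ (thetaIndex X).Vbad →
    (logShellsDH X logv).StarPacket v → Module.End ℚ ((logShellsDH X logv).StarPacket v))
  (Mmod : ℤ → ∀ j : (thetaIndex X).LabelStar, Set ((logShellsDH X logv).GlobalPacket j.1))
  (region : ℤ → ∀ j : (thetaIndex X).LabelStar, FinDivisor M → ∀ vQ : (thetaIndex X).VQ,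
    Set ((logShellsDH X logv).Packet j.1 vQ))
  (n : ℤ) {HT : Type} {LogLink : HT → HT → Type} {IsFull : ∀ {s t : HT}, LogLink s t → Prop}
  (lat : LGPGaussianLogThetaLattice LogLink IsFull)
  {Frd : Type} {IsoF : Frd → Frd → Type} {Ob : Frd → Type} {realify : Frd → Frd} {Strip : Type}
  {IsoS : Strip → Strip → Type} {Mv : ∀ v : (thetaIndex X).V, v ∈ (thetaIndex X).Vbad → Type}
  [∀ v h, Monoid (Mv v h)]
  (sig : GlobalLGPFrobenioidSignature (thetaIndex X).lstar (thetaIndex X).V (· ∈ (thetaIndex X).Vbad)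
    Frd IsoF Ob realify Strip IsoS Mv)
  (split : SplittingMonoids Mv) {ObΔ : Type} {N : ∀ v : (thetaIndex X).V, v ∈ (thetaIndex X).Vbad → Type}
  [∀ v h, Monoid (N v h)] (qData : QPilotData ObΔ N)
  (tq : ∀ (pp : Nat.Primes) (x : (thetaIndex X).Fibre (.inr pp)), haveI : Fact (pp : ℕ).Prime := ⟨pp.2⟩; kOf X pp.1 x)
  (t : ∀ (pp : Nat.Primes) (_ : Fin X.lstar) (x : (thetaIndex X).Fibre (.inr pp)),
    haveI : Fact (pp : ℕ).Prime := ⟨pp.2⟩; kOf X pp.1 x)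
  (htq0 : ∀ pp x, tq pp x ≠ 0)
  (htq1 : ∀ (pp : Nat.Primes) (x : (thetaIndex X).Fibre (.inr pp)),
    haveI : Fact (pp : ℕ).Prime := ⟨pp.2⟩; placeOf X pp.1 x ∉ X.S → ‖tq pp x‖ = 1)

/-- Plumbing: a minimum over the capsule is unchanged by re-indexing the tuple with a permutation. [folklore] -/
private theorem inf'_comp_perm {ι α : Type} [Fintype ι] [Nonempty ι] (f : α → ℝ) (e : ι → α) (σ : Equiv.Perm ι) :
    Finset.univ.inf' Finset.univ_nonempty (fun a => f (e (σ a))) = Finset.univ.inf' Finset.univ_nonempty (fun a => f (e a)) := by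
  apply le_antisymm
  · refine Finset.le_inf' _ _ fun a _ => ?_
    have h := Finset.inf'_le (fun a => f (e (σ a))) (Finset.mem_univ (σ.symm a))
    simpa using h
  · exact Finset.le_inf' _ _ fun a _ => Finset.inf'_le (fun a => f (e a)) (Finset.mem_univ (σ a))

/-! ## §2. The explicit threshold -/

/-- **`¬ Licence` with an EXPLICIT threshold in the constants of [IUTchIV] Prop. 1.2.** For nonzero Θ-ideles, a prime
`p`, a label `j = i+1` and a place `x₀ | p`, writing `K = F_{x₀}`, `e = e(K/ℚ_p)`, `d = differentOrd`, `a = logRadiusA p e`,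
`b = logRadiusB p e`: if `p^{(j+1)(d+a+b)+1}·‖t_{Θ,j,x₀}‖ < ‖t_{q,x₀}‖` then Step (xi-f)'s licence FAILS for
`settingPrVolSharp … tq t …`. [claim: Mochizuki2012, status: disputed] -/
theorem not_licence_settingPrVolSharp_of_explicit (ht0 : ∀ pp i x, t pp i x ≠ 0) (pp : Nat.Primes)
    (i : Fin (thetaIndex X).lstar) (x₀ : (thetaIndex X).Fibre (.inr pp))
    (hdeep : haveI : Fact (pp : ℕ).Prime := ⟨pp.2⟩
      ((pp : ℕ) : ℝ) ^ ((((i : ℕ) : ℝ) + 2) * (differentOrd pp.1 (kOf X pp.1 x₀)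
          + logRadiusA pp.1 (absRamificationIdx pp.1 (kOf X pp.1 x₀))
          + logRadiusB pp.1 (absRamificationIdx pp.1 (kOf X pp.1 x₀))) + 1) * ‖t pp i x₀‖ < ‖tq pp x₀‖) :
    ¬ Thm311ToCor312.Licence
      (settingPrVolSharp X hlog M archPk archSub Ψ act Mmod region n lat sig split qData tq t htq0 htq1) := by
  classical
  haveI : Fact (pp : ℕ).Prime := ⟨pp.2⟩
  haveI hne : Nonempty ((thetaIndex X).Caps (Setting.labelSucc i)) := ⟨0⟩
  set P := presAtPr X hlog pp with hP
  set j := Setting.labelSucc (T := thetaIndex X) i with hj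
  have hp0 : (0 : ℝ) < (pp : ℕ) := by exact_mod_cast pp.2.pos
  have hp1 : (1 : ℝ) ≤ (pp : ℕ) := by exact_mod_cast pp.2.one_lt.le
  have hpq0 : ((pp : ℕ) : ℚ_[pp]) ≠ 0 := Nat.cast_ne_zero.2 pp.2.ne_zero
  have hI : 2 ≤ Fintype.card ((thetaIndex X).Caps j) := two_le_card_caps_labelSucc X i
  -- orders of the label ideles: `‖t_{Θ,j,x}‖ = p^{−λ(x)}`, `λ(x) = mx(x)/e(x)`
  have hmx : ∀ x : (thetaIndex X).Fibre (.inr pp), ∃ m : ℤ,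
      ‖labelIdele X t pp j x‖ = ((pp : ℕ) : ℝ) ^ (-((m : ℝ) / absRamificationIdx pp.1 (kOf X pp.1 x))) :=
    fun x => exists_norm_eq_rpow pp.1 _ (labelIdele_ne_zero X t ht0 pp j x)
  choose mx hmx using hmx
  set lam : (thetaIndex X).Fibre (.inr pp) → ℝ := fun x => (mx x : ℝ) / absRamificationIdx pp.1 (kOf X pp.1 x) with hlam
  -- the symmetric exponent `N(v⃗) = ⌊min_a λ(v⃗_a) − d_I − a_I⌋` and scalar function `c(v⃗) = p^{N(v⃗)}·s⁻¹`
  set Nf : ((thetaIndex X).Caps j → (thetaIndex X).Fibre (.inr pp)) → ℤ := fun e =>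
    ⌊Finset.univ.inf' Finset.univ_nonempty (fun a => lam (e a)) - dSum pp.1 (P.kk e) - aSum pp.1 (P.kk e)⌋ with hNf
  set s : ℚ_[pp] := shellScalar pp.1 (I := (thetaIndex X).Caps j) with hs
  have hs0 : s ≠ 0 := shellScalar_ne_zero pp.1
  -- realisations of `p^{−b_I}` per summand
  have hh : ∀ e : (thetaIndex X).Caps j → (thetaIndex X).Fibre (.inr pp), ∃ h : ∀ a, P.kk e a, RealizesNegB pp.1 (P.kk e) h :=
    fun e => exists_realizesNegB pp.1 (P.kk e)
  choose h hh using hh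
  -- symmetry of `Nf`
  have hdSum : ∀ (σ : Equiv.Perm ((thetaIndex X).Caps j)) e, dSum pp.1 (P.kk (e ∘ ⇑σ)) = dSum pp.1 (P.kk e) :=
    fun σ e => Equiv.sum_comp σ (fun a => differentOrd pp.1 (P.kk e a))
  have haSum : ∀ (σ : Equiv.Perm ((thetaIndex X).Caps j)) e, aSum pp.1 (P.kk (e ∘ ⇑σ)) = aSum pp.1 (P.kk e) :=
    fun σ e => Equiv.sum_comp σ (fun a => logRadiusA pp.1 (absRamificationIdx pp.1 (P.kk e a)))
  have hNsymm : ∀ (σ : Equiv.Perm ((thetaIndex X).Caps j)) e, Nf (e ∘ ⇑σ) = Nf e := by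
    intro σ e
    show ⌊Finset.univ.inf' Finset.univ_nonempty (fun a => lam (e (σ a))) - _ - _⌋ = ⌊_ - _ - _⌋
    rw [inf'_comp_perm lam e σ, hdSum σ e, haSum σ e]
  -- `c(v⃗)·I_{v⃗} = p^{N(v⃗)}·log_p(R^×_{v⃗})`
  have hcI : ∀ e, ((((pp : ℕ) : ℚ_[pp]) ^ Nf e * s⁻¹) • logShell pp.1 (P.kk e)) =
      (((pp : ℕ) : ℚ_[pp]) ^ Nf e) • (logPacket pp.1 (P.kk e) : Set (P.X e)) := by
    intro e
    show _ • (shellScalar pp.1 (I := (thetaIndex X).Caps j) • (logPacket pp.1 (P.kk e) : Set (P.X e))) = _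
    rw [smul_smul, ← hs, inv_mul_cancel_right₀ hs0]
  refine not_licence_settingPrVolSharp_of_latticeBound X hlog M archPk archSub Ψ act Mmod region n lat sig split qData tq
    t htq0 htq1 pp i (fun e => ((pp : ℕ) : ℚ_[pp]) ^ Nf e * s⁻¹)
    (fun σ e => by show ((pp : ℕ) : ℚ_[pp]) ^ Nf (e ∘ ⇑σ) * s⁻¹ = _; rw [hNsymm σ e]) ?_
    (fun z => dEquiv pp.1 (P.kk z.1) (ppow pp.1 (P.kk z.1) (Nf z.1) * purePacket pp.1 (P.kk z.1) (h z.1)) z.2)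
    (fun z => dEquiv_ppow_mul_purePacket_ne_zero pp.1 (P.kk z.1) (Nf z.1) (ne_zero_of_realizesNegB pp.1 (P.kk z.1) (hh z.1)) z.2) ?_ (fun _ => x₀)
    (Classical.choice (inferInstance : Nonempty (DIdx pp.1 (P.kk fun _ => x₀)))) ?_
  · -- the sharp boxes lie in `p^{N(v⃗)}·log_p(R^×_{v⃗})`: Prop. 1.2 (ii) at the identity + monotonicity in the exponent
    intro e
    rw [hcI e]
    have h1 := iota_smul_normalizedPacket_subset_zpow_smul_logPacket pp.1 (P.kk e) hI (i := Fin.last _)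
      (m := mx (e (Fin.last _))) (g := labelIdele X t pp j (e (Fin.last _))) (hmx (e (Fin.last _)))
    refine h1.trans (zpow_smul_logPacket_anti pp.1 (P.kk e) (Int.floor_le_floor ?_))
    have hmin : Finset.univ.inf' Finset.univ_nonempty (fun a => lam (e a)) ≤ lam (e (Fin.last _)) :=
      Finset.inf'_le _ (Finset.mem_univ _)
    show _ - dSum pp.1 (P.kk e) - aSum pp.1 (P.kk e) ≤
      (mx (e (Fin.last _)) : ℝ) / absRamificationIdx pp.1 (P.kk e (Fin.last _)) - dSum pp.1 (P.kk e) - aSum pp.1 (P.kk e)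
    have : lam (e (Fin.last _)) = (mx (e (Fin.last _)) : ℝ) / absRamificationIdx pp.1 (P.kk e (Fin.last _)) := rfl
    linarith
  · -- the radii `ψ_{v⃗}(p^{N(v⃗)}·⊗h)` bound the coordinates of `p^{N(v⃗)}·log_p(R^×_{v⃗})`
    intro e y hy i'
    rw [hcI e] at hy
    exact norm_dEquiv_le_of_mem_zpow_smul_logPacket pp.1 (P.kk e) (hh e) (Nf e) hy i'
  · -- at the constant tuple the radius is `p^{−N₀}·p^{(j+1)b} ≤ p^{(j+1)(d+a+b)+1}·‖t_{Θ,j,x₀}‖ < ‖t_{q,x₀}‖`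
    set e₀ : (thetaIndex X).Caps j → (thetaIndex X).Fibre (.inr pp) := fun _ => x₀ with he₀
    set i₀ := Classical.choice (inferInstance : Nonempty (DIdx pp.1 (P.kk e₀))) with hi₀
    show ‖dEquiv pp.1 (P.kk e₀) (ppow pp.1 (P.kk e₀) (Nf e₀) * purePacket pp.1 (P.kk e₀) (h e₀)) i₀‖ < ‖tq pp (e₀ (Fin.last _))‖
    rw [norm_dEquiv_ppow_mul_purePacket pp.1 (P.kk e₀) (hh e₀)]
    -- the constants at the constant tuple
    set K := kOf X pp.1 x₀ with hK
    set dK : ℝ := differentOrd pp.1 K with hdK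
    set aK : ℝ := logRadiusA pp.1 (absRamificationIdx pp.1 K) with haK
    set bK : ℝ := logRadiusB pp.1 (absRamificationIdx pp.1 K) with hbK
    have hcard : (Fintype.card ((thetaIndex X).Caps j) : ℝ) = ((i : ℕ) : ℝ) + 2 := by
      rw [show Fintype.card ((thetaIndex X).Caps j) = (j : ℕ) + 1 from Fintype.card_fin _, hj, Setting.labelSucc,
        Fin.val_succ]
      push_cast
      ring
    have hd0 : dSum pp.1 (P.kk e₀) = (((i : ℕ) : ℝ) + 2) * dK := by
      show ∑ _a : (thetaIndex X).Caps j, differentOrd pp.1 K = _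
      rw [Finset.sum_const, Finset.card_univ, nsmul_eq_mul, hcard]
    have ha0 : aSum pp.1 (P.kk e₀) = (((i : ℕ) : ℝ) + 2) * aK := by
      show ∑ _a : (thetaIndex X).Caps j, logRadiusA pp.1 (absRamificationIdx pp.1 K) = _
      rw [Finset.sum_const, Finset.card_univ, nsmul_eq_mul, hcard]
    have hb0 : bSum pp.1 (P.kk e₀) = (((i : ℕ) : ℝ) + 2) * bK := by
      show ∑ _a : (thetaIndex X).Caps j, logRadiusB pp.1 (absRamificationIdx pp.1 K) = _
      rw [Finset.sum_const, Finset.card_univ, nsmul_eq_mul, hcard]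
    have hinf : Finset.univ.inf' Finset.univ_nonempty (fun a : (thetaIndex X).Caps j => lam (e₀ a)) = lam x₀ :=
      le_antisymm (Finset.inf'_le _ (Finset.mem_univ (0 : (thetaIndex X).Caps j)))
        (Finset.le_inf' _ _ fun _ _ => le_rfl)
    have hNf0 : Nf e₀ = ⌊lam x₀ - (((i : ℕ) : ℝ) + 2) * dK - (((i : ℕ) : ℝ) + 2) * aK⌋ := by
      show ⌊Finset.univ.inf' Finset.univ_nonempty (fun a => lam (e₀ a)) - dSum pp.1 (P.kk e₀) - aSum pp.1 (P.kk e₀)⌋ = _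
      rw [hinf, hd0, ha0]
    have hN0 : (lam x₀ - (((i : ℕ) : ℝ) + 2) * dK - (((i : ℕ) : ℝ) + 2) * aK : ℝ) < (Nf e₀ : ℝ) + 1 := by
      rw [hNf0]
      exact Int.lt_floor_add_one _
    -- `‖t_{Θ,j,x₀}‖ = p^{−λ(x₀)}`
    have htn : ‖t pp i x₀‖ = ((pp : ℕ) : ℝ) ^ (-lam x₀) := by
      rw [← labelIdele_labelSucc X t pp i x₀]
      exact hmx x₀
    -- compare exponents
    have hexp : ((pp : ℕ) : ℝ) ^ (-(Nf e₀) : ℤ) * ((pp : ℕ) : ℝ) ^ bSum pp.1 (P.kk e₀) ≤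
        ((pp : ℕ) : ℝ) ^ ((((i : ℕ) : ℝ) + 2) * (dK + aK + bK) + 1) * ‖t pp i x₀‖ := by
      rw [htn, ← Real.rpow_intCast, ← Real.rpow_add hp0, ← Real.rpow_add hp0, hb0]
      refine Real.rpow_le_rpow_of_exponent_le hp1 ?_
      push_cast
      linarith
    exact lt_of_le_of_lt hexp hdeep

/-! ## §3. Realising ideles: the threshold in orders of `t_q` -/

section Realising

variable (ht0 : ∀ pp i x, t pp i x ≠ 0)
  (ht : ∀ (pp : Nat.Primes) (i : Fin X.lstar) (x : (thetaIndex X).Fibre (.inr pp)),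
    haveI : Fact (pp : ℕ).Prime := ⟨pp.2⟩
    Real.log ‖t pp i x‖ = -(X.thetaPilot i (placeOf X pp.1 x)) * logNorm F (placeOf X pp.1 x) /
      localDegree F (placeOf X pp.1 x))
  (htq : ∀ (pp : Nat.Primes) (x : (thetaIndex X).Fibre (.inr pp)),
    haveI : Fact (pp : ℕ).Prime := ⟨pp.2⟩
    Real.log ‖tq pp x‖ = -(X.qPilot (placeOf X pp.1 x)) * logNorm F (placeOf X pp.1 x) /
      localDegree F (placeOf X pp.1 x))

include ht0 ht htq in
/-- **Explicit case A for REALISING ideles**: at a place `x₀ | p` and label `j = i+1`, with `K = F_{x₀}` and `d, a, b` as above,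
`p^{(j+1)(d+a+b)+1} · ‖t_{q,x₀}‖^{j²−1} < 1 ⟹ ¬ Licence` — in orders: «`(j²−1)·ord_p(t_{q,x₀}) > (j+1)(d+a+b) + 1`».
[claim: Mochizuki2012, status: disputed] -/
theorem not_licence_settingPrVolSharp_of_realises_explicit (pp : Nat.Primes) (i : Fin (thetaIndex X).lstar)
    (x₀ : (thetaIndex X).Fibre (.inr pp))
    (hdeep : haveI : Fact (pp : ℕ).Prime := ⟨pp.2⟩
      ((pp : ℕ) : ℝ) ^ ((((i : ℕ) : ℝ) + 2) * (differentOrd pp.1 (kOf X pp.1 x₀)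
          + logRadiusA pp.1 (absRamificationIdx pp.1 (kOf X pp.1 x₀))
          + logRadiusB pp.1 (absRamificationIdx pp.1 (kOf X pp.1 x₀))) + 1) *
        ‖tq pp x₀‖ ^ (((i : ℕ) + 1) ^ 2 - 1) < 1) :
    ¬ Thm311ToCor312.Licence
      (settingPrVolSharp X hlog M archPk archSub Ψ act Mmod region n lat sig split qData tq t htq0 htq1) := by
  haveI : Fact (pp : ℕ).Prime := ⟨pp.2⟩
  refine not_licence_settingPrVolSharp_of_explicit X hlog M archPk archSub Ψ act Mmod region n lat sig split qData tq t
    htq0 htq1 ht0 pp i x₀ ?_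
  have hq0 : 0 < ‖tq pp x₀‖ := norm_pos_iff.mpr (htq0 pp x₀)
  rw [norm_thetaIdele_eq_pow_of_realises X t ht0 ht tq htq0 htq pp i x₀]
  have hk : ((i : ℕ) + 1) ^ 2 = (((i : ℕ) + 1) ^ 2 - 1) + 1 := by
    have : 1 ≤ ((i : ℕ) + 1) ^ 2 := Nat.one_le_pow _ _ (Nat.succ_pos _)
    omega
  calc _ = (((pp : ℕ) : ℝ) ^ ((((i : ℕ) : ℝ) + 2) * (differentOrd pp.1 (kOf X pp.1 x₀)
          + logRadiusA pp.1 (absRamificationIdx pp.1 (kOf X pp.1 x₀))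
          + logRadiusB pp.1 (absRamificationIdx pp.1 (kOf X pp.1 x₀))) + 1) *
        ‖tq pp x₀‖ ^ (((i : ℕ) + 1) ^ 2 - 1)) * ‖tq pp x₀‖ := by
        conv_lhs => rw [hk, pow_succ]
        ring
    _ < 1 * ‖tq pp x₀‖ := mul_lt_mul_of_pos_right hdeep hq0
    _ = ‖tq pp x₀‖ := one_mul _

end Realising

end Real

end Thm311

end IUTFork

end Summit.ABC

end
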